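import Summits.PneNP.PneNP.Theses.UniformStream
import Summits.PneNP.PneNP.Theorems.UniformStreamUniformMagnificationStubSpeedup
import Summits.PneNP.PneNP.Theorems.UniformStreamUniformMagnificationStubGoodProg
import Summits.PneNP.PneNP.Theorems.UniformStreamUniformMagnificationStubSeed
import Summits.PneNP.PneNP.Theorems.UniformStreamUniformMagnificationPadCoreC
import Summits.PneNP.PneNP.Theorems.UniformStreamUniformMagnificationStubSearchStream
import Summits.PneNP.PneNP.Theorems.UniformStreamUniformMagnificationStubPadAssembly
import Summits.PneNP.PneNP.Theorems.UniformStreamUniformMagnificationStubWrapperGlue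
import Literature.Computability.Complexity.CircuitEvalPrograms
import Literature.Computability.Complexity.ClayProblemProofs
import Literature.Computability.Complexity.PRelHierarchy

/-!
# Crux `UniformMagnification` (stmt-PneNP-16047, route UniformStream) — line `registered`, lead-reshaped skeleton

The crux is McKay–Murray–Williams 2019, Thm. 1.3 typed in the tree's model (contrapositive):
`¬ PneNP → ∀ s, IsTimeConstructible s → ∃ c A M₀ M₁ M₂, …` — under `P = NP`, for every
time-constructible size function `s` ONE uniform one-pass streaming algorithm (three `TM2` machines: init
reads `bin N`, update reads `⟨st, b⟩`, accept reads the final state; space AND steps `s(⌊log₂N⌋)^c + c`)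
decides `MCSP[s]`.

THE LINE (MMW19 §4 Algorithm 1 + §5, re-cut for the tree's machine model; the birth skeleton's composition
idea "poly-time one-pass COMPRESSOR for `MCSP[s]` + the collapse + the model step", reshaped by the lead):

* `stub_goodProg` — circuits are certified by CLEAN PROGRAMS of the tree's circuit-evaluation machine
  (`CircEval.isClean`, `CircEval.tabCount`, `CircEval.rotCode`, `CircEval.evalFn`): a good program computes a
  function of `B₂`-complexity `≤ t` (`CircEval.exists_circuit_evalFn`), every function of complexity `≤ t`
  has a short good program (`CircEval.progOf`, `vmSpec_progOf`, `vmSpec_rotCode_proj`), and goodness is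
  decidable in `P` (the transducers `cleanT`/`tabMarksT` of `MCSPProofs`). (`GoodProgSpec`.)
* `stub_searchStream` — MMW's Algorithm 1 with block length 1 UNDER THE COLLAPSE: from `GoodProgSpec` and
  `NP ⊆ P`, a word compressor `(ι, δ, α)` for `MCSPSize s` with `ι, δ ∈ FP`, `α ∈ P`: the state after a prefix
  `p` of an arity-`n` table is `⟨flags, 1ⁿ, 1^{s n}, bitsOf (n+1) |p|, ⟨D, 1^{2(W-|D|)}⟩⟩` with `D` a good program
  whose table extends `p`; the next `D` is found by the certificate search of Arora–Barak Thm. 2.18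
  (`exists_searchFn_of_NP_subset_P`) on the relation "`D'` good ∧ `∀ j ≤ |p|`, row `j` of `D'` agrees with
  row `j` of `D` / with `b`", which is `P ∩ coNP`, hence in `P` under `NP ⊆ P` (`co_P_holds`). No oracle
  machine is programmed. (`CompressorSpec s`.)
* `stub_seed` — ONE machine writes the seed `⟨⟨tail (bin N), 1^{s ⌊log₂N⌋}⟩, bin N⟩` from `bin N` within
  `s(⌊log₂N⌋)^c + c` steps: `x ↦ ⟨tail x, x⟩` then `mapFstAux` of the unary clock of `s`
  (`exists_unaryClock_of_timeConstructible`); this is where `IsTimeConstructible s` is consumed. (`SeedSpec s`.)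
* `stub_speedup` — LINEAR SPEED-UP for Mathlib `TM2` over `{0,1}`: every `TM2ComputableAux Bool Bool` is
  simulated `D` times faster up to the additive overhead `(|input| + |output|)/D + 3` (standardise and
  flatten by `TM2Flat.exists_aprogFin_of_outputsWithin`, then compile the flat binary program to a `TM2`
  machine whose statement at address `pc` unrolls `D·e` program steps — multi-pop statements).
  (`SpeedupSpec`; Hartmanis–Stearns 1965 in the tree's model.)
* `stub_padCore` + `stub_padAssembly` — the linear-time PADDED update/accept machines: for `δ ∈ FP` (non-lengthening) and
  `α ∈ P` there are `k, C`, total maps `U`, `acc` and machines computing them in `C·|ST| + C` steps on every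
  state word `ST`, such that on a well-padded state `⟨st, 1ᵀ⟩` with `k(⌊log₂(|st|+1)⌋+1) ≤ ⌊log₂(T+1)⌋` they
  compute `⟨δ ⟨st,[b]⟩, 1ᵀ⟩`, resp. `[st ∈ α]`, and `|U ST b| ≤ max |ST| 2` always (guard by iterated halving,
  then `mapFstAux (flagAux M_δ)`; junk / under-padded states are answered by a short dead word).
  (`PadUpdateSpec`.)
* `stub_wrapperGlue` — the MODEL STEP: `SpeedupSpec → PadUpdateSpec → WrapperSpec s`: pad the compressor's
  initial state by `2^{k(⌊log₂(m₀+1)⌋+1)}` ones (an `FP` map, so the init machine is seed ; ι ; pad), speed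
  the padded machines up by `D = 2(C+3)` so that they halt within `|ST|/2 + 4 ≤ max 8 |ST|` steps, and take
  `c` large; `HasSpace` from `|U ST b| ≤ max |ST| 2`, `Decides` by induction along the run.
* `uniformMagnification_of_specs` (PROVED here): `¬PneNP ⇒ NP ⊆ P` (model bridges `P_bool_eq_holds`,
  `NP_bool_eq_holds`), feed the wrapper with the search compressor and the seed machine; and
  `UniformMagnification_of : UniformMagnification` — the crux BY NAME from the declared stubs.

References: D. M. McKay, C. D. Murray, R. R. Williams, *Weak lower bounds on resource-bounded compression
imply strong separations of complexity classes*, STOC 2019, Thm. 1.2, Thm. 1.3, §4 (Algorithm 1), §5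
[MckayMurrayWilliams2019]; S. Arora, B. Barak, *Computational Complexity* (2009), Thm. 2.18 (search from
decision), Thm. 5.4, Claim 1.6, §1.3 [AroraBarakCC2009]; J. Hartmanis, R. E. Stearns, *On the computational
complexity of algorithms*, Trans. AMS 117 (1965), Thm. 2 (linear speed-up).
-/

set_option linter.dupNamespace false -- `Summit.PneNP.PneNP.…` is the layout-mandated namespace

namespace Summit.PneNP.PneNP.Cruxes.UniformMagnification.Birth

open _root_.Computability
open Literature.Computability.Complexity Literature.Computability.MetaComplexity

/-! ### The interface -/

/-- The route's single resource budget `N ↦ s(⌊log₂ N⌋)^c + c` (space AND steps). -/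
def bound (s : ℕ → ℕ) (c : ℕ) (N : ℕ) : ℕ :=
  s (Nat.log 2 N) ^ c + c

/-- Uniform one-pass streaming decidability of `L` within budget `S` — LITERALLY the matrix of the crux. -/
def UStream (S : ℕ → ℕ) (L : Language Bool) : Prop :=
  ∃ (A : StreamingAlgorithm) (M₀ M₁ M₂ : Turing.TM2ComputableAux Bool Bool),
    A.HasSpace S ∧
    (∀ N : ℕ, M₀.OutputsWithin (encodeNat N) (A.init N) (S N)) ∧
    (∀ (N : ℕ) (st : List Bool) (b : Bool), st.length ≤ S N →
      M₁.OutputsWithin (boolPair st [b]) (A.update N st b) (S N)) ∧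
    (∀ (N : ℕ) (st : List Bool), st.length ≤ S N →
      M₂.OutputsWithin st (encodeBool (A.accept N st)) (S N)) ∧
    A.Decides L

/-- The SEED of input length `N`: `⟨⟨tail (bin N), 1^{s(⌊log₂ N⌋)}⟩, bin N⟩` (`|tail (bin N)| = ⌊log₂ N⌋`;
this nesting is what `mapFstAux` of the unary clock of `s` produces from `⟨tail (bin N), bin N⟩`). -/
def seed (s : ℕ → ℕ) (N : ℕ) : List Bool :=
  boolPair (boolPair (encodeNat N).tail (List.replicate (s (Nat.log 2 N)) true)) (encodeNat N)

/-- `SeedSpec s`: ONE machine writes the seed from `bin N` within the budget, for all `N`. -/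
def SeedSpec (s : ℕ → ℕ) : Prop :=
  ∃ (c : ℕ) (M : Turing.TM2ComputableAux Bool Bool),
    ∀ N : ℕ, M.OutputsWithin (encodeNat N) (seed s N) (bound s c N)

/-- The run of a word compressor `(ι, δ)` on the input `x`: start from `ι (seed s |x|)` and fold the
transition `st ↦ δ ⟨st, [b]⟩` over the bits of `x`. -/
def crun (s : ℕ → ℕ) (ι δ : List Bool → List Bool) (x : List Bool) : List Bool :=
  x.foldl (fun st b => δ (boolPair st [b])) (ι (seed s x.length))

/-- `IsCompressor s L ι δ α`: the word maps `(ι, δ)` with accepting set `α` form a one-pass automaton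
deciding `L` from the seed, whose transition never lengthens a state and whose initial state fits a budget
`s(⌊log₂N⌋)^k + k`. -/
structure IsCompressor (s : ℕ → ℕ) (L : Language Bool) (ι δ : List Bool → List Bool)
    (α : Language Bool) : Prop where
  /-- the automaton decides `L` -/
  decides : ∀ x : List Bool, crun s ι δ x ∈ α ↔ x ∈ L
  /-- the initial state fits the budget shape of the route -/
  init_le : ∃ k : ℕ, ∀ N : ℕ, (ι (seed s N)).length ≤ bound s k N
  /-- the transition never lengthens a state -/
  update_le : ∀ (st : List Bool) (b : Bool), (δ (boolPair st [b])).length ≤ st.length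

/-- `CompressorSpec s`: some compressor for `MCSPSize s` with `ι, δ ∈ FP`, `α ∈ P`. -/
def CompressorSpec (s : ℕ → ℕ) : Prop :=
  ∃ (ι δ : List Bool → List Bool) (α : Language Bool),
    ι ∈ FP ∧ δ ∈ FP ∧ α ∈ Classes.P ∧ IsCompressor s (MCSPSize s) ι δ α

/-- `WrapperSpec s` (the model step, generic in the language). -/
def WrapperSpec (s : ℕ → ℕ) : Prop :=
  ∀ (L : Language Bool) (ι δ : List Bool → List Bool) (α : Language Bool),
    IsCompressor s L ι δ α → ι ∈ FP → δ ∈ FP → α ∈ Classes.P → SeedSpec s →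
      ∃ c : ℕ, UStream (bound s c) L

/-- The Boolean function of arity `n` computed by the circuit-evaluation machine on the program `D`. -/
def progFun (n : ℕ) (D : List Bool) : (Fin n → Bool) → Bool :=
  fun x => (CircEval.evalFn (boolPair (List.ofFn x) D)).headD false

/-- Good programs for size `t` at arity `n`: clean, and either at most `t` table instructions with `t ≠ 0`,
or a bare rotation code (a projection, complexity `0`). -/
def GoodProg (n t : ℕ) (D : List Bool) : Prop :=
  CircEval.isClean D = true ∧ ((CircEval.tabCount D ≤ t ∧ t ≠ 0) ∨ ∃ k < n, D = CircEval.rotCode k)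

/-- Length bound for complete good programs (`CircEval.length_progOf_le`, `|rotCode k| = 2k`). -/
def goodLen (n t : ℕ) : ℕ := (t + 1) * (8 * (n + t) + 10) + 2 * n

/-- The language of good programs: words `⟨⟨u, v⟩, D⟩` with `GoodProg |u| |v| D` (components read by the
total projections `fstP`/`sndP`). -/
def GoodLang : Language Bool :=
  {w | GoodProg (fstP (fstP w)).length (sndP (fstP w)).length (sndP w)}

/-- `GoodProgSpec`: soundness, completeness and `P`-decidability of good programs. -/
def GoodProgSpec : Prop :=
  (∀ (n t : ℕ) (D : List Bool), GoodProg n t D → circuitSizeOver B2 (progFun n D) ≤ t) ∧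
  (∀ (n t : ℕ) (f : (Fin n → Bool) → Bool), circuitSizeOver B2 f ≤ t →
      ∃ D : List Bool, GoodProg n t D ∧ progFun n D = f ∧ D.length ≤ goodLen n t) ∧
  GoodLang ∈ Classes.P

/-- `SpeedupSpec`: linear speed-up for Mathlib `TM2` machines over `{0,1}`. -/
def SpeedupSpec : Prop :=
  ∀ (M : Turing.TM2ComputableAux Bool Bool) (D : ℕ), 0 < D →
    ∃ M' : Turing.TM2ComputableAux Bool Bool, ∀ (l l' : List Bool) (m : ℕ),
      M.OutputsWithin l l' m → M'.OutputsWithin l l' ((m + l.length + l'.length) / D + 3)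

/-- A padded state: `⟨st, 1ᵀ⟩`. -/
def fmt (st : List Bool) (T : ℕ) : List Bool := boolPair st (List.replicate T true)

/-- `lg m = ⌊log₂ (m+1)⌋` (the number of rounds of "pop one symbol, halve the rest"). -/
def lg (m : ℕ) : ℕ := Nat.log 2 (m + 1)

/-- Adequate padding: `k (lg m + 1) ≤ lg T` (so that `(m+1)^k ≤ T + 1`). -/
def Adequate (k m T : ℕ) : Prop := k * (lg m + 1) ≤ lg T

/-- `PadUpdateSpec`: linear-time padded update / accept machines for `δ ∈ FP` (non-lengthening), `α ∈ P`. -/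
def PadUpdateSpec : Prop :=
  ∀ (δ : List Bool → List Bool) (α : Language Bool), δ ∈ FP → α ∈ Classes.P →
    (∀ (st : List Bool) (b : Bool), (δ (boolPair st [b])).length ≤ st.length) →
    ∃ (k C : ℕ) (U : List Bool → Bool → List Bool) (acc : List Bool → Bool)
      (M₁ M₂ : Turing.TM2ComputableAux Bool Bool),
      (∀ (ST : List Bool) (b : Bool), M₁.OutputsWithin (boolPair ST [b]) (U ST b) (C * ST.length + C)) ∧
      (∀ (ST : List Bool) (b : Bool), (U ST b).length ≤ max ST.length 2) ∧
      (∀ (st : List Bool) (T : ℕ) (b : Bool), Adequate k st.length T →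
          U (fmt st T) b = fmt (δ (boolPair st [b])) T) ∧
      (∀ ST : List Bool, M₂.OutputsWithin ST (encodeBool (acc ST)) (C * ST.length + C)) ∧
      (∀ (st : List Bool) (T : ℕ), Adequate k st.length T → (acc (fmt st T) = true ↔ st ∈ α))

/-- `PadCoreSpec`: the linear-time STAGE-A machines of the padded update / accept (pure plumbing, for every
guard constant `k`): on `⟨ST, b⟩` (resp. `ST`), where `ST = st·st ++ x y ++ rest` doubles `st` up to the first
unequal pair `x ≠ y`, emit `⟨1·⟨st,[b]⟩ | 00, 1^{|rest|}⟩` (resp. `1·st | 00`) according to the guard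
`k(⌊log₂(|st|+1)⌋+1) ≤ ⌊log₂(|rest|+1)⌋`; a state word with no unequal pair is answered `⟨00, ε⟩` (resp. `00`). -/
def PadCoreSpec : Prop :=
  ∀ k : ℕ, ∃ (C : ℕ) (MA MA' : Turing.TM2ComputableAux Bool Bool),
    (∀ (st rest : List Bool) (x y b : Bool), x ≠ y →
      MA.OutputsWithin (boolPair (st.flatMap (fun c => [c, c]) ++ x :: y :: rest) [b])
        (boolPair (if k * (Nat.log 2 (st.length + 1) + 1) ≤ Nat.log 2 (rest.length + 1)
            then true :: boolPair st [b] else [false, false])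
          (List.replicate rest.length true))
        (C * (2 * st.length + rest.length) + C)) ∧
    (∀ (st tl : List Bool) (b : Bool), tl.length ≤ 1 →
      MA.OutputsWithin (boolPair (st.flatMap (fun c => [c, c]) ++ tl) [b]) (boolPair [false, false] [])
        (C * st.length + C)) ∧
    (∀ (st rest : List Bool) (x y : Bool), x ≠ y →
      MA'.OutputsWithin (st.flatMap (fun c => [c, c]) ++ x :: y :: rest)
        (if k * (Nat.log 2 (st.length + 1) + 1) ≤ Nat.log 2 (rest.length + 1)
          then true :: st else [false, false])
        (C * (2 * st.length + rest.length) + C)) ∧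
    (∀ (st tl : List Bool), tl.length ≤ 1 →
      MA'.OutputsWithin (st.flatMap (fun c => [c, c]) ++ tl) [false, false] (C * st.length + C))

/-! ### Registered stubs

ALL LANDED (imported above, same namespace `Summit.PneNP.PneNP.Cruxes.UniformMagnification.Birth`):
`stub_speedup` (Theorems/UniformStreamUniformMagnificationStubSpeedup.lean), `stub_goodProg` (…StubGoodProg),
`stub_seed` (…StubSeed), `stub_padCore` (…PadCoreC, helpers …Variants160471/2), `stub_searchStream`
(…StubSearchStream, helpers …Variants160473/4/5), `stub_padAssembly` (…StubPadAssembly), `stub_wrapperGlue`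
(…StubWrapperGlue). Every stub is stated in LIBRARY VOCABULARY ONLY (no definition of this file occurs in a
stub's type); the bridging lemmas below rewrite each into the interface `def`s by unfolding. -/

/-! ### Bridging the stubs to the interface -/

/-- `GoodProgSpec` from its stub (definitional unfolding). -/
theorem goodProgSpec_of_stub : GoodProgSpec := by
  obtain ⟨h1, h2, h3⟩ := stub_goodProg
  refine ⟨fun n t D hD => h1 n t D hD.1 hD.2, fun n t f hf => ?_, h3⟩
  obtain ⟨D, hc, hg, hf', hl⟩ := h2 n t f hf
  exact ⟨D, ⟨hc, hg⟩, hf', hl⟩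

/-- `SpeedupSpec` from its stub (definitional unfolding). -/
theorem speedupSpec_of_stub : SpeedupSpec := stub_speedup

/-- `PadCoreSpec` from its stub (definitional unfolding). -/
theorem padCoreSpec_of_stub : PadCoreSpec := stub_padCore

/-- `PadUpdateSpec` from `stub_padAssembly` and `stub_padCore`. -/
theorem padUpdateSpec_of_stubs : PadUpdateSpec := stub_padAssembly stub_padCore

/-- `SeedSpec s` from its stub (definitional unfolding). -/
theorem seedSpec_of_stub (s : ℕ → ℕ) (hs : IsTimeConstructible s) : SeedSpec s := stub_seed s hs

/-- `CompressorSpec s` under the collapse, from `stub_searchStream` and `stub_goodProg`. -/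
theorem compressorSpec_of_stubs (s : ℕ → ℕ) (hs : ∀ n, n ≤ s n)
    (hNP : Nondeterministic.NP ⊆ Classes.P) : CompressorSpec s := by
  obtain ⟨ι, δ, α, hι, hδ, hα, hdec, hinit, hupd⟩ :=
    stub_searchStream stub_goodProg.1 stub_goodProg.2.1 stub_goodProg.2.2 s hs hNP
  exact ⟨ι, δ, α, hι, hδ, hα, ⟨hdec, hinit, hupd⟩⟩

/-- `WrapperSpec s` from `stub_wrapperGlue`, `stub_speedup`, `stub_padAssembly`, `stub_padCore`. -/
theorem wrapperSpec_of_stubs (s : ℕ → ℕ) (hs : ∀ n, n ≤ s n) : WrapperSpec s := by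
  intro L ι δ α hc hι hδ hα hseed
  exact stub_wrapperGlue stub_speedup (stub_padAssembly stub_padCore) s hs L ι δ α hc.decides hc.init_le
    hc.update_le hι hδ hα hseed

/-! ### The proved composition -/

/-- `¬ PneNP` puts `NP` inside `P` in the prelude's classes (model bridges `P_bool_eq_holds`,
`NP_bool_eq_holds`). -/
theorem NP_subset_P_of_not_pneNP (hnp : ¬ _root_.PneNP) : Nondeterministic.NP ⊆ Classes.P := by
  have hP : PNPWave0.P Bool = Classes.P := P_bool_eq_holds
  have hNP : PNPWave0.NP Bool = Nondeterministic.NP := NP_bool_eq_holds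
  by_contra hcon
  obtain ⟨L, hL, hLP⟩ := Set.not_subset.1 hcon
  apply hnp
  show ∃ L : Language Bool, L ∈ PNPWave0.NP Bool ∧ L ∉ PNPWave0.P Bool
  exact ⟨L, by rw [hNP]; exact hL, by rw [hP]; exact hLP⟩

/-- **The composition with explicit hypotheses** (kernel-checked, no `sorry`; conclusion = the BODY of
`UniformMagnification`). -/
theorem uniformMagnification_of_specs
    (h_comp : ∀ s : ℕ → ℕ, (∀ n, n ≤ s n) → Nondeterministic.NP ⊆ Classes.P → CompressorSpec s)
    (h_seed : ∀ s : ℕ → ℕ, IsTimeConstructible s → SeedSpec s)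
    (h_wrapper : ∀ s : ℕ → ℕ, (∀ n, n ≤ s n) → WrapperSpec s) :
    ¬ _root_.PneNP → ∀ s : ℕ → ℕ, IsTimeConstructible s →
      ∃ (c : ℕ) (A : StreamingAlgorithm) (M₀ M₁ M₂ : Turing.TM2ComputableAux Bool Bool),
        A.HasSpace (fun N => s (Nat.log 2 N) ^ c + c) ∧
        (∀ N : ℕ, M₀.OutputsWithin (encodeNat N) (A.init N) (s (Nat.log 2 N) ^ c + c)) ∧
        (∀ (N : ℕ) (st : List Bool) (b : Bool), st.length ≤ s (Nat.log 2 N) ^ c + c →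
          M₁.OutputsWithin (boolPair st [b]) (A.update N st b) (s (Nat.log 2 N) ^ c + c)) ∧
        (∀ (N : ℕ) (st : List Bool), st.length ≤ s (Nat.log 2 N) ^ c + c →
          M₂.OutputsWithin st (encodeBool (A.accept N st)) (s (Nat.log 2 N) ^ c + c)) ∧
        A.Decides (MCSPSize s) := by
  intro hnp s hs
  have hs1 : ∀ n, n ≤ s n := hs.1
  obtain ⟨ι, δ, α, hι, hδ, hα, hcomp⟩ := h_comp s hs1 (NP_subset_P_of_not_pneNP hnp)
  obtain ⟨c, A, M₀, M₁, M₂, hspace, hinit, hupd, hacc, hdec⟩ :=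
    h_wrapper s hs1 (MCSPSize s) ι δ α hcomp hι hδ hα (h_seed s hs)
  exact ⟨c, A, M₀, M₁, M₂, hspace, hinit, hupd, hacc, hdec⟩

/-- **THE SKELETON THEOREM `UniformMagnification_of`.** The crux
`Summit.PneNP.PneNP.Theses.UniformStream.UniformMagnification`, concluded BY NAME from the DECLARED stubs
through the sorry-free composition `uniformMagnification_of_specs`. -/
theorem UniformMagnification_of : Summit.PneNP.PneNP.Theses.UniformStream.UniformMagnification :=
  uniformMagnification_of_specs compressorSpec_of_stubs seedSpec_of_stub wrapperSpec_of_stubs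

end Summit.PneNP.PneNP.Cruxes.UniformMagnification.Birth
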